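import Mathlib
import Summits.MatrixMultiplication.MatrixMultiplication.Theorems.GradedDesignFamily.Negative.GramTraceRank
import Summits.MatrixMultiplication.MatrixMultiplication.Theorems.GradedDesignFamily.Negative.Mixing

/-!
# Spectral flat-size lemma for an orthogonal projector
# (crux `LevelGradedCohnUmans.GradedDesignFamily`, stmt-MatrixMultiplication-7610; negative side,
# line `quadratic-extension-level-one-cell`, stub `sq_le_finrank_rows_mul_of_projector`)

Let `P` be a real symmetric idempotent `V × V` matrix (an orthogonal projector) with constant
diagonal `P ω ω = ρ`, and suppose the entrywise square `Q := (P i j ^ 2)_{i,j}` satisfies the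
Rayleigh bound `x ⬝ Q x ≤ μ (x ⬝ x)` on the vectors of coordinate sum zero.  Then for every
`Φ ⊆ V`, writing `s := |Φ|`, `n := |V|` and `rk Φ := dim span {P_ω : ω ∈ Φ}` (the span of the
rows of `P` indexed by `Φ`),

* `sq_le_finrank_rows_mul_of_projector` — `(ρ s)² ≤ rk Φ · (ρ s² / n + μ (s - s² / n))`.

This is the abstract spectral flat-size lemma of the line's negative programme (L1 on the shadow
`Ω = SL₂(q) \ GL₂(q²)`): with `P` the projector onto the invariant test space, flats of large
corank have few points.

Proof: the composition of the two engines already in the tree.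
(1) The Gram trace–rank inequality `sum_sq_sq_le_finrank_mul_sum_gram_sq` for the family of rows
`v ω := P ω` (`ω ∈ Φ`) gives `(Σ_{ω∈Φ} ‖P_ω‖²)² ≤ rk Φ · Σ_{ω,ω'∈Φ} ⟨P_ω, P_ω'⟩²`.
(2) Since `P` is a symmetric idempotent, `⟨P_ω, P_ω'⟩ = (P Pᵀ) ω ω' = P ω ω'`; in particular
`‖P_ω‖² = P ω ω = ρ`, so the left-hand side is `(ρ s)²` and the Gram sum is
`Σ_{ω,ω'∈Φ} (P ω ω')² = 1_Φ ⬝ Q 1_Φ`.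
(3) `Q` is symmetric with constant row sums `Σ_j (P i j)² = P i i = ρ`, so the expander mixing
lemma `indicator_mulVec_le_of_rayleigh` bounds `1_Φ ⬝ Q 1_Φ ≤ ρ s² / n + μ (s - s² / n)`.

Sorry-free; axioms `propext`, `Classical.choice`, `Quot.sound`.
-/

set_option linter.dupNamespace false

open scoped BigOperators

namespace Summit.MatrixMultiplication.MatrixMultiplication.Theorems.GradedDesignFamily.Negative

/-- **Spectral flat-size lemma** (abstract form).  For a real symmetric idempotent matrix `P`
with constant diagonal `ρ` whose entrywise square `Q` satisfies `x ⬝ Q x ≤ μ (x ⬝ x)` on `𝟙^⊥`,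
every `Φ ⊆ V` satisfies
`(ρ |Φ|)² ≤ dim span {P_ω : ω ∈ Φ} · (ρ |Φ|² / |V| + μ (|Φ| - |Φ|² / |V|))`. [folklore] -/
theorem sq_le_finrank_rows_mul_of_projector :
    ∀ {V : Type} [Fintype V] [DecidableEq V] (P : Matrix V V ℝ) (ρ μ : ℝ),
      P.IsSymm → P * P = P → (∀ ω, P ω ω = ρ) →
      (∀ x : V → ℝ, ∑ v, x v = 0 →
        dotProduct x ((Matrix.of fun i j => P i j ^ 2).mulVec x) ≤ μ * dotProduct x x) →
      ∀ Φ : Finset V,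
        (ρ * Φ.card) ^ 2 ≤
          (Module.finrank ℝ (Submodule.span ℝ ((fun ω : V => P ω) '' (Φ : Set V))) : ℝ) *
            (ρ * (Φ.card : ℝ) ^ 2 / Fintype.card V + μ * ((Φ.card : ℝ) - (Φ.card : ℝ) ^ 2 / Fintype.card V)) := by
  intro V _ _ P ρ μ hP hPP hdiag hμ Φ
  -- the entrywise square `Q` and the indicator vector `1_Φ`
  set Q : Matrix V V ℝ := Matrix.of fun i j => P i j ^ 2 with hQ
  -- Gram entries of the rows of a symmetric idempotent: `⟨P_i, P_j⟩ = P i j`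
  have hgram : ∀ i j, ∑ p, P i p * P j p = P i j := fun i j => by
    have h := congrFun (congrFun hPP i) j
    rw [Matrix.mul_apply] at h
    rw [← h]
    exact Finset.sum_congr rfl fun p _ => by rw [hP.apply p j]
  -- in particular `Σ_p (P i p)² = P i i = ρ`
  have hnorm : ∀ i, ∑ p, P i p ^ 2 = ρ := fun i => by
    rw [← hdiag i, ← hgram i i]
    exact Finset.sum_congr rfl fun p _ => sq _
  -- (1) Gram trace–rank inequality for the rows indexed by `Φ`
  have h1 := sum_sq_sq_le_finrank_mul_sum_gram_sq (fun ω : Φ => P ω)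
  have hrange : Set.range (fun ω : Φ => P ω) = (fun ω : V => P ω) '' (Φ : Set V) := by
    ext f
    simp
  have hlhs : ∑ ω : Φ, ∑ p, P ω p ^ 2 = ρ * Φ.card := by
    simp only [hnorm, Finset.sum_const, Finset.card_univ, Fintype.card_coe, nsmul_eq_mul]
    ring
  have hrhs : ∑ ω : Φ, ∑ ω' : Φ, (∑ p, P ω p * P ω' p) ^ 2 = ∑ ω ∈ Φ, ∑ ω' ∈ Φ, P ω ω' ^ 2 := by
    simp only [hgram]
    calc ∑ ω : Φ, ∑ ω' : Φ, P ω ω' ^ 2 = ∑ ω : Φ, ∑ ω' ∈ Φ, P ω ω' ^ 2 :=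
          Finset.sum_congr rfl fun ω _ => Finset.sum_coe_sort Φ (fun ω' => P ω ω' ^ 2)
      _ = ∑ ω ∈ Φ, ∑ ω' ∈ Φ, P ω ω' ^ 2 := Finset.sum_coe_sort Φ (fun ω => ∑ ω' ∈ Φ, P ω ω' ^ 2)
  rw [hrange, hlhs, hrhs] at h1
  -- (2) the Gram sum is the quadratic form of `Q` at the indicator vector of `Φ`
  have hquad : dotProduct (fun v => if v ∈ Φ then (1 : ℝ) else 0)
      (Q.mulVec fun v => if v ∈ Φ then (1 : ℝ) else 0) = ∑ ω ∈ Φ, ∑ ω' ∈ Φ, P ω ω' ^ 2 := by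
    simp only [dotProduct, Matrix.mulVec, hQ, Matrix.of_apply, boole_mul, mul_boole,
      Finset.sum_ite_mem, Finset.univ_inter]
  -- (3) expander mixing for `Q`: symmetric, row sums `ρ`, Rayleigh bound `μ` on `𝟙^⊥`
  have hQsymm : Q.IsSymm := Matrix.IsSymm.ext fun i j => by
    simp only [hQ, Matrix.of_apply, hP.apply i j]
  have hQone : (Q.mulVec fun _ => (1 : ℝ)) = fun _ => ρ := by
    funext i
    simp only [Matrix.mulVec, dotProduct, hQ, Matrix.of_apply, mul_one, hnorm i]
  have h2 := indicator_mulVec_le_of_rayleigh Q hQsymm ρ μ hQone hμ Φ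
  rw [hquad] at h2
  -- (4) chain the two inequalities
  exact h1.trans (mul_le_mul_of_nonneg_left h2 (Nat.cast_nonneg _))

end Summit.MatrixMultiplication.MatrixMultiplication.Theorems.GradedDesignFamily.Negative
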